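import Summits.CriticalPhenomena.PercolationContinuityZ3.Theorems.Transplant.GrigorchukWitnessSnowballStep
import Summits.CriticalPhenomena.PercolationContinuityZ3.Theorems.Transplant.GrigorchukWitnessNearCriticalLRO
import Literature.Probability.MarkovChains.ReturnProbabilityDecayFromGrowth
import HarnessLib

/-!
# Stretched-exponential return decay of the simple random walk on `Cay(𝔊; a, b, c, d)`, in closed-walk form, modulo Woess 2000 Cor. 14.5(b)
# (W4 item (2b): the «HK» input of the small parameter's tail / `UniformPolygons`, as `∃ γ > 0`)

builds on p205010 (kernel theorem, internal audit signed; external expert review pending) — nothing in this file uses p205010.  Lane `prim-bschramm`,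
seat `prim-bschramm-stmt` gen 41 (port pen) under lead g28's rulings #9305 / #9308 / #9314 (W4 S-item (2b), director-frontier g15 #9163 (3)); proof-only
helper file (`--supports stmt-CriticalPhenomena-4575 --as helper`): NO definition, no `@[conjecture]`, nothing about `θ(p_c)`.

THE THEOREM.  **`stdCay_closedWalks_decay (hW : Woess2000_closedWalks_decay_of_growth) : ∃ γ > 0, ∀ v, ∃ C₁ C₂ > 0, ∀ n,
#{closed walks of length n at v in Cay(𝔊; a,b,c,d)} ≤ C₁ · 4ⁿ · exp(−C₂ n^γ)`** — i.e. the simple random walk's return probability on the first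
Grigorchuk group's standard Cayley graph decays at least stretched-exponentially, `p⁽ⁿ⁾(v, v) ≤ C₁ e^{−C₂ n^γ}` for SOME `γ > 0`.  INPUTS: the printed
fact «ReturnProbabilityDecayFromGrowth» `Woess2000_closedWalks_decay_of_growth` (Woess 2000 Cor. 14.5(b) ∘ Thm. 4.18: growth `≥ e^{c n^α}` ⇒ return
`≤ C₁ e^{−C₂ n^{α/(α+2)}}` on vertex-transitive graphs) taken as the HYPOTHESIS `hW` (a named Literature fact, never asserted — the gate records a
conditional result), and three KERNEL facts of the tree: the stretched-exponential growth LOWER bound «GrigorchukWitnessSnowballStep»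
`stdCay_growthLower : ∃ a > 0, ∀ v, GrowthLower stdCay v a` (SOME `a > 0`, no numerical value), `stdCay_degree = 4`, `isGraphTransitive_mulCayley`
(+ «GrigorchukWitnessNearCriticalLRO» `stdCay_connected`).  The exponent is `γ = a′/(a′ + 2)` with `a′ = min a 1` (`GrowthLower` is monotone in the exponent downwards,
`growthLower_mono`).  NO 𝔊-specific named fact; no growth or heat-kernel EXPONENT is typed: in print `a = 1/2` (Grigorchuk 1984) gives `γ = 1/5` by this
route, and the Følner route (Erschler–Zheng 2017 Ex. 2.4: `Føl_𝔊(n) ≥ 2^{Cn/6}`, + Lyons–Peres 2016 Cor. 6.32(iii)) gives `γ = 1/3` — CITATIONS ONLY,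
neither is needed by the W4 line (VERDICTS :511 (2): `UniformPolygons` needs SOME `γ > 0`).

NOT IN THIS FILE (design recorded for «GrigorchukPowerReturnDecay», L-sized): the `k`-UNIFORM bound for `Cay(𝔊^k; std)`.  A closed walk of length `n`
in `𝔊^k` is an interleaving of per-coordinate closed walks of lengths `N_1 + ⋯ + N_k = n` (multinomial decomposition), so
`#closed_n^{(k)}(1) = Σ_N (n; N_1,…,N_k) ∏_i W(N_i)` with `W` the closed-walk count of `Cay(𝔊)`.  Since `W(m) ≤ 4^{m−1} < 4^m` for `m ≥ 1` (the last
letter is forced), the constant `C₁` of this file's bound can be normalised to `1` after shrinking `C₂` (`W(m) ≤ 4^m e^{−C₂′ m^γ}` for ALL `m ≥ 1`,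
`W(0) = 1`), and subadditivity `Σ_i N_i^γ ≥ n^γ` (`γ ≤ 1`) gives `#closed_n^{(k)}(1) ≤ (4k)ⁿ e^{−C₂′ n^γ}`, i.e. `p_n^{(k)}(e,e) ≤ e^{−C₂′ n^γ}` UNIFORMLY in
`k`.  The interleaving bijection is the only heavy part.
[cite: Woess2000, Cor. 14.5(b), Thm. 4.18] [cite: Grigorchuk1984, Thm. (lower bound)] [cite: ErschlerZheng2020, §1 (Følner function remark)]
-/

noncomputable section

namespace Summit.CriticalPhenomena.PercolationContinuityZ3.Theorems.Transplant

namespace Grigorchuk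

open SimpleGraph Filter Literature.Barriers.CriticalPhenomena Literature.Probability.MarkovChains SnowballSqueeze
open scoped Classical

/-- **`GrowthLower` is monotone DOWN in the exponent**: `exp(c m^b) ≤ exp(c m^a)` for `b ≤ a`, `m ≥ 1`, `c > 0`. [folklore] -/
theorem growthLower_mono {V : Type} {G : SimpleGraph V} {o : V} {a b : ℝ} (hb : b ≤ a) (h : GrowthLower G o a) : GrowthLower G o b := by
  obtain ⟨c, hc, hev⟩ := h
  refine ⟨c, hc, ?_⟩
  filter_upwards [hev, eventually_ge_atTop 1] with m hm hm1
  refine le_trans (Real.exp_le_exp.2 (mul_le_mul_of_nonneg_left ?_ hc.le)) hm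
  exact Real.rpow_le_rpow_of_exponent_le (by exact_mod_cast hm1) hb

/-- **Stretched-exponential return decay on `Cay(𝔊; a, b, c, d)`, closed-walk form, modulo Woess 2000 Cor. 14.5(b)**: there is `γ > 0` such that at
every vertex `v`, `#{closed walks of length n at v} ≤ C₁ · 4ⁿ · exp(−C₂ n^γ)` for some `C₁, C₂ > 0` and all `n` — equivalently the simple random walk's
return probability is `≤ C₁ e^{−C₂ n^γ}`.  `γ = a′/(a′+2)`, `a′ = min a 1` with `a` the KERNEL growth exponent of `stdCay_growthLower`; the printed fact
enters ONLY as the hypothesis `hW`. [cite: Woess2000, Cor. 14.5(b), Thm. 4.18] [cite: Grigorchuk1984, Thm. (lower bound)] -/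
theorem stdCay_closedWalks_decay (hW : Woess2000_closedWalks_decay_of_growth) :
    ∃ γ : ℝ, 0 < γ ∧ ∀ v : ↥grigorchukGroup, ∃ C₁ C₂ : ℝ, 0 < C₁ ∧ 0 < C₂ ∧ ∀ n : ℕ,
      (Fintype.card {p : stdCay.Walk v v // p.length = n} : ℝ) ≤ C₁ * 4 ^ n * Real.exp (-(C₂ * (n : ℝ) ^ γ)) := by
  obtain ⟨a, ha, hgrow⟩ := stdCay_growthLower
  set a' : ℝ := min a 1 with ha'
  have ha'0 : 0 < a' := lt_min ha one_pos
  have ha'1 : a' ≤ 1 := min_le_right _ _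
  refine ⟨a' / (a' + 2), by positivity, fun v => ?_⟩
  have hG : GrowthLower stdCay v a' := growthLower_mono (min_le_left _ _) (hgrow v)
  obtain ⟨C₁, C₂, hC₁, hC₂, hn⟩ :=
    hW stdCay v a' stdCay_connected (isGraphTransitive_mulCayley _) ha'0 ha'1 hG
  refine ⟨C₁, C₂, hC₁, hC₂, fun n => ?_⟩
  have h := hn n
  rw [stdCay_degree v] at h
  convert h using 3
  norm_num

/-- **The same at the identity, packaged as «some stretched-exponential return decay»** (the form the W4 card's `UniformPolygons` / small-parameter
tail consumes: SOME `γ > 0`, constants free). [cite: Woess2000, Cor. 14.5(b), Thm. 4.18] -/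
theorem stdCay_closedWalks_decay_one (hW : Woess2000_closedWalks_decay_of_growth) :
    ∃ γ C₁ C₂ : ℝ, 0 < γ ∧ 0 < C₁ ∧ 0 < C₂ ∧ ∀ n : ℕ,
      (Fintype.card {p : stdCay.Walk 1 1 // p.length = n} : ℝ) ≤ C₁ * 4 ^ n * Real.exp (-(C₂ * (n : ℝ) ^ γ)) := by
  obtain ⟨γ, hγ, h⟩ := stdCay_closedWalks_decay hW
  obtain ⟨C₁, C₂, hC₁, hC₂, hn⟩ := h 1
  exact ⟨γ, C₁, C₂, hγ, hC₁, hC₂, hn⟩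

/-! ### Appendix (T′): uniform constants — closed-walk counts are left-translation invariant (lead g28 #9360, refuter note #9358) -/

/-- **Closed-walk counts do not grow along an injective graph homomorphism**: `f` maps the closed walks of length `n` at `u` injectively to closed walks of
length `n` at `f u` (Mathlib `Walk.map`, `length_map`, `map_injective_of_injective`). [folklore] -/
theorem card_closedWalks_le_of_injective {V W : Type*} {G : SimpleGraph V} {G' : SimpleGraph W} [DecidableEq V] [G.LocallyFinite] [DecidableEq W]
    [G'.LocallyFinite] (f : G →g G') (hf : Function.Injective f) (u : V) (w : W) (hw : f u = w) (n : ℕ) :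
    Fintype.card {p : G.Walk u u // p.length = n} ≤ Fintype.card {p : G'.Walk w w // p.length = n} := by
  subst hw
  refine Fintype.card_le_of_injective (fun p => ⟨p.1.map f, by rw [Walk.length_map]; exact p.2⟩) fun p q h => ?_
  exact Subtype.ext (Walk.map_injective_of_injective hf u u (congrArg Subtype.val h))

/-- **On `Cay(𝔊; a, b, c, d)` the closed-walk count at any vertex `v` is at most the one at `1`** (left multiplication by `v⁻¹` is a graph automorphism;
with the reverse translation the counts are in fact equal — only `≤` is needed here). [cite: BenjaminiSchramm1996, §2 (Cayley graphs are transitive)] -/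
theorem card_closedWalks_stdCay_le_one (v : ↥grigorchukGroup) (n : ℕ) :
    Fintype.card {p : stdCay.Walk v v // p.length = n} ≤ Fintype.card {p : stdCay.Walk 1 1 // p.length = n} :=
  card_closedWalks_le_of_injective (leftMulIso ({aG, bG, cG, dG} : Finset ↥grigorchukGroup) v⁻¹).toHom
    (leftMulIso ({aG, bG, cG, dG} : Finset ↥grigorchukGroup) v⁻¹).injective v 1 (by simp) n

/-- **Stretched-exponential return decay on `Cay(𝔊; a, b, c, d)` with constants UNIFORM in the vertex** — the form the product formula's base bound
`hb` («GrigorchukPowerWalkProduct» `card_closedWalks_gkCay_le`) consumes: `∃ γ, C₁, C₂ > 0, ∀ v n, #closed_n(v) ≤ C₁ · 4ⁿ · exp(−C₂ n^γ)`.  From the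
`v = 1` statement and `card_closedWalks_stdCay_le_one`; conditional ONLY on the printed Woess fact `hW`. [cite: Woess2000, Cor. 14.5(b), Thm. 4.18] -/
theorem stdCay_closedWalks_decay_uniform (hW : Woess2000_closedWalks_decay_of_growth) :
    ∃ γ C₁ C₂ : ℝ, 0 < γ ∧ 0 < C₁ ∧ 0 < C₂ ∧ ∀ (v : ↥grigorchukGroup) (n : ℕ),
      (Fintype.card {p : stdCay.Walk v v // p.length = n} : ℝ) ≤ C₁ * 4 ^ n * Real.exp (-(C₂ * (n : ℝ) ^ γ)) := by
  obtain ⟨γ, C₁, C₂, hγ, hC₁, hC₂, hn⟩ := stdCay_closedWalks_decay_one hW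
  refine ⟨γ, C₁, C₂, hγ, hC₁, hC₂, fun v n => le_trans ?_ (hn n)⟩
  exact_mod_cast card_closedWalks_stdCay_le_one v n

end Grigorchuk

end Summit.CriticalPhenomena.PercolationContinuityZ3.Theorems.Transplant

end
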